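import Summits.AtomisticToContinuum.BoseEinsteinCondensation.Theses.BECHardSphereReduction

/-!
# Line `core-growth` — crux `HardCoreDominates` (stmt-AtomisticToContinuum-11884) of route
# `BECHardSphereReduction` — ALTERNATIVE line (crux-strategist s1, 2026-08-17); it does NOT replace
# the lead's line `birth` (coupling path `v + t·1_{Iic R}`).

The path.  Fix `v` (measurable radial profile, `v r = 0` for `r > R`).  Instead of raising the COUPLING on
the whole range (`birth`), grow a HARD CORE inside `v`:
`w_s := v + ⊤·1_{Iic s}` (`= v ⊔ HS_s`), `s ∈ (0, R]`.  The endpoint `s = R` is the crux's hard sphere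
EXACTLY (`v + ⊤·1_{Iic R} = ⊤·1_{Iic R}` pointwise, because `v` vanishes beyond `R`), so no limit is taken
at the hard-sphere end; the family `s ↦ w_s` is a family of NESTED DIRICHLET DOMAINS
`Ω_{N,L}(s) = {all pair distances > s}` carrying the same soft background `v`, and the approach to `v` is
at the SMALL-core end `s → 0⁺`, where the excised tubes have vanishing capacity (`d = 3`).

* `stub_coreGrowthAntitone` (stub A, load-bearing — the physics): in a dilute window
  `N·R³ ≤ η₀(v,R)·L³`, `0 < s ≤ s' ≤ R ⇒ condensateNumber w_{s'} N L ≤ condensateNumber w_s N L`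
  ("growing a hard core inside a fixed repulsive background depletes the condensate").  Its `v = 0`
  instance is, through the proved scale covariance `condensateNumber_dilate` / route item
  `HardSphereScaling`, EXACTLY the route's rank-4 crux `HardSphereBoxMonotone` (stmt-11886): the
  mechanism is Dirichlet DOMAIN MONOTONICITY / spectral geometry of `Ω_{N,L}(s)`, not a
  coupling-constant covariance.
* `stub_vanishingCoreUSC` (stub B, functional analysis at fixed `N, L`): upper semicontinuity of the
  ground-state condensate number at a vanishing hard core, in a dilute window:
  `∀ ε > 0 ∃ s₀ > 0 ∀ s ∈ (0, s₀], condensateNumber w_s N L ≤ condensateNumber v N L + ε`.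
  Mechanism: for `v` with an essential hard core of radius `a > 0` it is an identity for `s ≤ a`
  (`w_s = v` a.e.); for `v` without essential hard sets, `H_v` has a simple positive ground state
  (Perron–Frobenius) and the tubes `{|xᵢ - xⱼ| ≤ s}` have capacity `O(s) → 0` at fixed `(N, L)`
  (Rauch–Taylor / Mosco convergence ⇒ norm-resolvent convergence ⇒ ground states converge in `L²`,
  `λ_max(γ)` is `L²`-Lipschitz on `N`-particle states); for `v` with hard SHELLS and no core the
  dilute guard makes the unconfined sector the gapped ground sector uniformly in `N` (trapped pair
  costs `≥ 2π²/R²`, insertion costs `O(ρ^{2/3})`), on which `w_s` and `v` coincide.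
* `HardCoreDominates_of (hA hB) : HardCoreDominates` sorry-free: with `η₀ := min η₁ η₂`, for every
  `ε > 0` and `s := min s₀ R`, `cn(HS_R) = cn(w_R) ≤ cn(w_s) ≤ cn(v) + ε`.

Why it dodges the live line's hardest goal: `birth` needs `t ↦ cn(v + t·1_{Iic R})` non-increasing for
ALL finite couplings `t` (an imaginary-time covariance sign at every `t`) plus a strong-coupling limit
`t → ∞` (Rellich to the hard core).  Here the comparison family never leaves the class "hard core +
fixed soft background", every step is a comparison of the SAME operator on two nested domains, the
hard-sphere endpoint is reached without a limit, and the `v = 0` sub-family is an item the route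
already staffs (`HardSphereBoxMonotone`), so its provers/refuters work on stub A's model case directly.

Disproof used: no `Cruxes/HardCoreDominates/Disproof.lean` exists (gen 1).  Checked against the sibling's
landed negatives: `Theorems/HardCoreExtension/Negative/HighDensityObstruction.lean`
(`not_condensateNumber_mono_potential` — UNguarded upward monotonicity in the potential is false by
packing; stub A runs DOWNWARD in the domain with the dilute guard, packed corners give `0 ≤ …`) and
`Cruxes/HardCoreExtension/Disproof.lean` §7 (`not_monotoneLimitTransfer`: fixed-box upper semicontinuity
fails for hard shells TUNED to an in/out degeneracy — stub B carries the dilute guard, under which a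
trapped pair costs `2π²/a² − O(ρ^{2/3}) > 0` uniformly in `N`, Disproof §13 (B)).
-/

namespace Summit.AtomisticToContinuum.BoseEinsteinCondensation.Cruxes.HardCoreDominates.CoreGrowth

open Literature.MathematicalPhysics.QuantumManyBody.BoseGas

/-! ## Audit names of the stub statements (hypotheses of the glue theorem BY NAME) -/

namespace Goal

/-- Statement of stub A `stub_coreGrowthAntitone` (verbatim). -/
abbrev stub_coreGrowthAntitone : Prop :=
  ∀ (v : ℝ → ENNReal) (R : ℝ), Measurable v → 0 < R → (∀ r : ℝ, R < r → v r = 0) →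
    ∃ η₀ : ℝ, 0 < η₀ ∧ ∀ (N : ℕ) (L : ℝ), (N : ℝ) * R ^ 3 ≤ η₀ * L ^ 3 →
      ∀ s s' : ℝ, 0 < s → s ≤ s' → s' ≤ R →
        Literature.MathematicalPhysics.QuantumManyBody.BoseGas.condensateNumber
            (v + Set.indicator (Set.Iic s') (fun _ : ℝ => (⊤ : ENNReal))) N L ≤
          Literature.MathematicalPhysics.QuantumManyBody.BoseGas.condensateNumber
            (v + Set.indicator (Set.Iic s) (fun _ : ℝ => (⊤ : ENNReal))) N L

/-- Statement of stub B `stub_vanishingCoreUSC` (verbatim). -/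
abbrev stub_vanishingCoreUSC : Prop :=
  ∀ (v : ℝ → ENNReal) (R : ℝ), Measurable v → 0 < R → (∀ r : ℝ, R < r → v r = 0) →
    ∃ η₀ : ℝ, 0 < η₀ ∧ ∀ (N : ℕ) (L : ℝ), (N : ℝ) * R ^ 3 ≤ η₀ * L ^ 3 →
      ∀ ε : NNReal, 0 < ε → ∃ s₀ : ℝ, 0 < s₀ ∧ ∀ s : ℝ, 0 < s → s ≤ s₀ →
        Literature.MathematicalPhysics.QuantumManyBody.BoseGas.condensateNumber
            (v + Set.indicator (Set.Iic s) (fun _ : ℝ => (⊤ : ENNReal))) N L ≤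
          Literature.MathematicalPhysics.QuantumManyBody.BoseGas.condensateNumber v N L + ε

end Goal

/-! ## Registered stubs (the only `sorry`s of this file) -/

/-- **stub A — CoreGrowthAntitone (nested Dirichlet domains with a soft background).** For every
measurable radial profile `v` vanishing beyond `R > 0` there is a dilute window `N·R³ ≤ η₀·L³` in
which the ground-state condensate number of `v + ⊤·1_{[0,s]}` is non-increasing in the hard-core
radius `s ∈ (0, R]`.  The `v = 0` instance is the route item `HardSphereBoxMonotone` (via
`HardSphereScaling`). -/
theorem stub_coreGrowthAntitone :
    ∀ (v : ℝ → ENNReal) (R : ℝ), Measurable v → 0 < R → (∀ r : ℝ, R < r → v r = 0) →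
      ∃ η₀ : ℝ, 0 < η₀ ∧ ∀ (N : ℕ) (L : ℝ), (N : ℝ) * R ^ 3 ≤ η₀ * L ^ 3 →
        ∀ s s' : ℝ, 0 < s → s ≤ s' → s' ≤ R →
          Literature.MathematicalPhysics.QuantumManyBody.BoseGas.condensateNumber
              (v + Set.indicator (Set.Iic s') (fun _ : ℝ => (⊤ : ENNReal))) N L ≤
            Literature.MathematicalPhysics.QuantumManyBody.BoseGas.condensateNumber
              (v + Set.indicator (Set.Iic s) (fun _ : ℝ => (⊤ : ENNReal))) N L := by
  sorry

/-- **stub B — VanishingCoreUSC (upper semicontinuity at a vanishing hard core, fixed `N, L`).**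
For every measurable radial profile `v` vanishing beyond `R > 0` there is a dilute window in which,
at each fixed `(N, L)`, adding a hard core of radius `s → 0⁺` to `v` raises the ground-state
condensate number by at most `ε`, eventually in `s`. -/
theorem stub_vanishingCoreUSC :
    ∀ (v : ℝ → ENNReal) (R : ℝ), Measurable v → 0 < R → (∀ r : ℝ, R < r → v r = 0) →
      ∃ η₀ : ℝ, 0 < η₀ ∧ ∀ (N : ℕ) (L : ℝ), (N : ℝ) * R ^ 3 ≤ η₀ * L ^ 3 →
        ∀ ε : NNReal, 0 < ε → ∃ s₀ : ℝ, 0 < s₀ ∧ ∀ s : ℝ, 0 < s → s ≤ s₀ →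
          Literature.MathematicalPhysics.QuantumManyBody.BoseGas.condensateNumber
              (v + Set.indicator (Set.Iic s) (fun _ : ℝ => (⊤ : ENNReal))) N L ≤
            Literature.MathematicalPhysics.QuantumManyBody.BoseGas.condensateNumber v N L + ε := by
  sorry

/-! ## Composition (sorry-free) -/

/-- The hard-core endpoint of the growth path is the crux's hard sphere on the nose: for a profile
`v` vanishing beyond `R`, `v + ⊤·1_{Iic R} = ⊤·1_{Iic R}` pointwise (`x + ⊤ = ⊤` on `[0,R]`,
`v = 0` beyond). [folklore] -/
theorem add_hardSphere_eq (v : ℝ → ENNReal) (R : ℝ) (hvR : ∀ r : ℝ, R < r → v r = 0) :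
    (v + Set.indicator (Set.Iic R) (fun _ : ℝ => (⊤ : ENNReal))) =
      Set.indicator (Set.Iic R) (fun _ : ℝ => (⊤ : ENNReal)) := by
  funext r
  by_cases hr : r ≤ R
  · have hmem : r ∈ Set.Iic R := hr
    simp [Set.indicator_of_mem hmem]
  · have hnmem : r ∉ Set.Iic R := hr
    have hv : v r = 0 := hvR r (lt_of_not_ge hr)
    simp [Set.indicator_of_notMem hnmem, hv]

/-- **Assembly of the line** (kernel-checked, no `sorry`; glue shape: hypotheses = the stubs by their
audit names `Goal.stub_*`, conclusion = the route decl by name): antitone core growth and upper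
semicontinuity at the vanishing core give the crux — with `η₀ := min η₁ η₂`, for every `ε > 0`,
`cn(HS_R) = cn(v ⊔ HS_R) ≤ cn(v ⊔ HS_{min s₀ R}) ≤ cn(v) + ε`. [folklore] -/
theorem HardCoreDominates_of (hA : Goal.stub_coreGrowthAntitone) (hB : Goal.stub_vanishingCoreUSC) :
    Summit.AtomisticToContinuum.BoseEinsteinCondensation.Theses.BECHardSphereReduction.HardCoreDominates := by
  intro v R hmeas hR hvR
  obtain ⟨η₁, hη₁, hanti⟩ := hA v R hmeas hR hvR
  obtain ⟨η₂, hη₂, husc⟩ := hB v R hmeas hR hvR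
  refine ⟨min η₁ η₂, lt_min hη₁ hη₂, fun N L hNL => ?_⟩
  -- the guard forces `0 ≤ L ^ 3`, so the window `min η₁ η₂` lies inside both windows
  have hL3 : 0 ≤ L ^ 3 := by
    by_contra hneg
    push Not at hneg
    have hlt : (N : ℝ) * R ^ 3 < 0 :=
      hNL.trans_lt (mul_neg_of_pos_of_neg (lt_min hη₁ hη₂) hneg)
    exact absurd hlt (not_lt.2 (by positivity))
  have hN₁ : (N : ℝ) * R ^ 3 ≤ η₁ * L ^ 3 :=
    hNL.trans (mul_le_mul_of_nonneg_right (min_le_left _ _) hL3)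
  have hN₂ : (N : ℝ) * R ^ 3 ≤ η₂ * L ^ 3 :=
    hNL.trans (mul_le_mul_of_nonneg_right (min_le_right _ _) hL3)
  have hHS := add_hardSphere_eq v R hvR
  -- `cn(HS_R) ≤ cn(v) + ε` for every `ε > 0`
  refine ENNReal.le_of_forall_pos_le_add fun ε hε _ => ?_
  obtain ⟨s₀, hs₀, hs⟩ := husc N L hN₂ ε hε
  have hspos : 0 < min s₀ R := lt_min hs₀ hR
  calc Literature.MathematicalPhysics.QuantumManyBody.BoseGas.condensateNumber
          (Set.indicator (Set.Iic R) (fun _ : ℝ => (⊤ : ENNReal))) N L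
        = Literature.MathematicalPhysics.QuantumManyBody.BoseGas.condensateNumber
            (v + Set.indicator (Set.Iic R) (fun _ : ℝ => (⊤ : ENNReal))) N L := by rw [hHS]
    _ ≤ Literature.MathematicalPhysics.QuantumManyBody.BoseGas.condensateNumber
            (v + Set.indicator (Set.Iic (min s₀ R)) (fun _ : ℝ => (⊤ : ENNReal))) N L :=
          hanti N L hN₁ (min s₀ R) R hspos (min_le_right _ _) le_rfl
    _ ≤ Literature.MathematicalPhysics.QuantumManyBody.BoseGas.condensateNumber v N L + ε :=
          hs (min s₀ R) hspos (min_le_left _ _)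

/-- **The skeleton applied to the (sorried) stubs**: `HardCoreDominates` modulo exactly
`stub_coreGrowthAntitone` and `stub_vanishingCoreUSC`. -/
theorem HardCoreDominates_proof :
    Summit.AtomisticToContinuum.BoseEinsteinCondensation.Theses.BECHardSphereReduction.HardCoreDominates :=
  HardCoreDominates_of stub_coreGrowthAntitone stub_vanishingCoreUSC

/-! ## Documentation (sorry-free modulo stub A): the `v = 0` instance of stub A is the route's
rank-4 crux `HardSphereBoxMonotone`, through the proved item `HardSphereScaling` -/

/-- A zero-particle trial state: the constant `1` on the one-point configuration space (so
`TrialState 0 L` is inhabited for every `L`). [folklore] -/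
noncomputable def trialStateZero (L : ℝ) : TrialState 0 L where
  ψ := fun _ => 1
  contDiff := contDiff_const
  eq_zero := fun X hX => (hX (fun i => i.elim0)).elim
  symm := fun _ _ => rfl
  norm_eq := by
    have h : (MeasureTheory.volume : MeasureTheory.Measure (Config 0)) Set.univ = 1 := by
      rw [MeasureTheory.volume_pi, MeasureTheory.Measure.pi_univ]
      simp
    simp [h]

/-- With no particles every occupation vanishes. [folklore] -/
theorem maxOccupation_zero_particles (Ψ : Config 0 → ℂ) : maxOccupation 0 Ψ = 0 := by
  simp [maxOccupation, occupation]

/-- With no particles every energy vanishes. [folklore] -/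
theorem energy_zero_particles (v : ℝ → ENNReal) (L : ℝ) (Ψ : TrialState 0 L) : energy v Ψ = 0 := by
  simp [energy, kineticDensity, interaction]

/-- With no particles the condensate number is `0` (for every potential and every `L`). [folklore] -/
theorem condensateNumber_zero_particles (v : ℝ → ENNReal) (L : ℝ) :
    condensateNumber v 0 L = 0 := by
  refine le_antisymm ?_ zero_le
  refine iSup₂_le fun δ _ => ?_
  refine (iInf₂_le (trialStateZero L) ?_).trans ?_
  · rw [energy_zero_particles]; exact zero_le
  · rw [maxOccupation_zero_particles]

/-- **Stub A at `v = 0` is `HardSphereBoxMonotone`.** Antitone core growth in the free background,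
read through the exact scale covariance of the hard-sphere family (route item `HardSphereScaling`,
PROVED: `Theorems.hardSphereScaling_proof`), gives the route's rank-4 crux verbatim: with `R = 1`,
`s = L₁/L₂ ≤ 1 = s'`, `cn(HS_1, N, L₁) ≤ cn(HS_{L₁/L₂}, N, L₁) = cn(HS_1, N, L₂)`. [folklore] -/
theorem hardSphereBoxMonotone_of (hA : Goal.stub_coreGrowthAntitone)
    (hS : Summit.AtomisticToContinuum.BoseEinsteinCondensation.Theses.BECHardSphereReduction.HardSphereScaling) :
    Summit.AtomisticToContinuum.BoseEinsteinCondensation.Theses.BECHardSphereReduction.HardSphereBoxMonotone := by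
  obtain ⟨η₀, hη₀, h⟩ := hA 0 1 measurable_const one_pos (fun _ _ => rfl)
  refine ⟨η₀, hη₀, fun N L₁ L₂ hN hL => ?_⟩
  rcases le_or_gt L₁ 0 with hL₁ | hL₁
  · -- a non-positive box under the guard holds no particle: both sides are `0 ≤ _`
    have hL₁3 : L₁ ^ 3 ≤ 0 := by nlinarith [sq_nonneg L₁]
    have hN0 : (N : ℝ) ≤ 0 := hN.trans (mul_nonpos_of_nonneg_of_nonpos hη₀.le hL₁3)
    have hN0' : N = 0 := Nat.eq_zero_of_le_zero (by exact_mod_cast hN0)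
    subst hN0'
    rw [condensateNumber_zero_particles]
    exact zero_le
  · have hL₂ : 0 < L₂ := hL₁.trans_le hL
    have hguard : (N : ℝ) * 1 ^ 3 ≤ η₀ * L₁ ^ 3 := by simpa using hN
    have hs : 0 < L₁ / L₂ := div_pos hL₁ hL₂
    have hs' : L₁ / L₂ ≤ 1 := (div_le_one hL₂).2 hL
    have key := h N L₁ hguard (L₁ / L₂) 1 hs hs' le_rfl
    simp only [zero_add] at key
    rw [hS (L₁ / L₂) L₁ N hs] at key
    have hLL : L₁ / (L₁ / L₂) = L₂ := by field_simp
    rwa [hLL] at key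

end Summit.AtomisticToContinuum.BoseEinsteinCondensation.Cruxes.HardCoreDominates.CoreGrowth
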